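import Mathlib
import Summits.ValiantsHypothesis.ValiantsHypothesis.Theorems.LacunarySymmetroidMatrixDescartesGramDualSigned
import Summits.ValiantsHypothesis.ValiantsHypothesis.Theorems.LacunarySymmetroidMatrixDescartesGramDualReduction

/-!
# `MatrixDescartes` (stmt-ValiantsHypothesis-18050) — Gram duality, part 8: THE EFFECTIVE SIZE OF A WORD IS THE
# RANK OF ITS GRAM MATRIX (spectral factorisation + the reduction of part 7)

HONEST FRAMING.  Cell `pub-symmetroid`, seat `val-sym-mdr-p2` (gen 19); helper file `--supports` the crux
`Theses.LacunarySymmetroid.MatrixDescartes` (OPEN), NO closure claim; companion of `…GramDualReduction`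
(`UᵀB⁻¹U = AᵀSA`, `det S ≠ 0` ⇒ `Z₊(X^eB + U diag(σX^δ) Uᵀ) = Z₊(X^eS⁻¹ + A diag(σX^δ) Aᵀ)`).  Nothing here bears
on the crux in its window, `stub_twoSided`, `DoorA26` / `DoorA34`, registers, or `VP ≠ VNP`.

* `eq_spectralFactor` — every real symmetric `C` factors as `C = AᵀSA` with `A` the (transposed) eigenvectors of the
  NON-ZERO eigenvalues (`A : {i // λᵢ ≠ 0} × ρ`) and `S = diag(λᵢ)_{λᵢ ≠ 0}` non-degenerate (`isUnit_det_spectralDiag`);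
  `card {i // λᵢ ≠ 0} = rank C` (Mathlib `IsHermitian.rank_eq_card_non_zero_eigs`).
* **`card_posRoots_base_eq_spectral` (EFFECTIVE SIZE = GRAM RANK).**  `det B ≠ 0`, `B` symmetric, `σⱼ ≠ 0`: the word
  `X^e B + U diag(σX^δ) Uᵀ` of size `card ι` has exactly as many distinct positive zeros of its determinant as the word
  `X^e S⁻¹ + A diag(σX^δ) Aᵀ` — SAME exponents, SAME signs — whose size is `rank(UᵀB⁻¹U) ≤ min(card ι, card ρ)`
  (`card_effective_eq_rank`, `rank_gram_le_min`), with base letter `S⁻¹ = diag(λᵢ⁻¹)` DIAGONAL of the same inertia as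
  the Gram matrix (the hypothesis `hC` is `GramDual.isHermitian_gram`, `…GramDualInertia`).  READING: only the non-degenerate quotient of (column span, `B⁻¹`) matters; e.g. a word all of
  whose letter columns lie in a `B⁻¹`-isotropic subspace plus one extra direction behaves like a `1 × 1` word.

[folklore] (spectral theorem + Sylvester).  Axioms `propext`, `Classical.choice`, `Quot.sound`.
-/

-- layout Summits/ValiantsHypothesis/ValiantsHypothesis forces the duplicated namespace component
set_option linter.dupNamespace false

namespace Summit.ValiantsHypothesis.ValiantsHypothesis.Theorems.LacunarySymmetroidMatrixDescartes

open Polynomial Matrix Finset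
open scoped BigOperators

namespace GramDual

variable {ι ρ : Type*} [Fintype ι] [DecidableEq ι] [Fintype ρ] [DecidableEq ρ]

/-- the signed column part (file-local notation, as in `…GramDualSigned`) -/
local notation3 (prettyPrint := false) "𝕊[" U ", " σ ", " δ "]" =>
  ((U : Matrix _ _ ℝ).map Polynomial.C
      * Matrix.diagonal (fun j => Polynomial.C ((σ : _ → ℝ) j) * (Polynomial.X : Polynomial ℝ) ^ (δ j : ℕ))
      * ((U : Matrix _ _ ℝ).map Polynomial.C)ᵀ)

/-- the signed primal word (file-local notation, as in `…GramDualSigned`) -/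
local notation3 (prettyPrint := false) "𝔽ₛ[" e ", " B ", " U ", " σ ", " δ "]" =>
  (((Polynomial.X : Polynomial ℝ) ^ (e : ℕ)) • (B : Matrix _ _ ℝ).map Polynomial.C + 𝕊[U, σ, δ])

/-! ## §1  Spectral factorisation through the non-zero eigenvalues -/

/-- **Spectral factorisation `C = AᵀSA` through the non-zero eigenvalues** of a real symmetric matrix:
`A_{i j} = P_{j i}` (`P` the orthogonal eigenvector matrix, `i` ranging over the non-zero eigenvalues) and
`S = diag(λᵢ)`. [folklore] -/
theorem eq_spectralFactor {C : Matrix ρ ρ ℝ} (hC : C.IsHermitian) :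
    C = (Matrix.of fun (i : {i // hC.eigenvalues i ≠ 0}) (j : ρ) => (hC.eigenvectorUnitary : Matrix ρ ρ ℝ) j i.1)ᵀ
        * Matrix.diagonal (fun i : {i // hC.eigenvalues i ≠ 0} => hC.eigenvalues i.1)
        * (Matrix.of fun (i : {i // hC.eigenvalues i ≠ 0}) (j : ρ) => (hC.eigenvectorUnitary : Matrix ρ ρ ℝ) j i.1) := by
  classical
  set P : Matrix ρ ρ ℝ := (hC.eigenvectorUnitary : Matrix ρ ρ ℝ) with hP
  set lam : ρ → ℝ := hC.eigenvalues with hlam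
  have hCeq : C = P * Matrix.diagonal lam * star P := by
    simpa [Unitary.conjStarAlgAut_apply, hP, hlam] using hC.spectral_theorem
  refine Matrix.ext fun j j' => ?_
  have hL : C j j' = ∑ i, P j i * lam i * P j' i := by
    rw [hCeq, Matrix.mul_apply]
    refine Finset.sum_congr rfl fun i _ => ?_
    rw [Matrix.mul_diagonal, Matrix.star_apply, star_trivial]
  have hR : ((Matrix.of fun (i : {i // hC.eigenvalues i ≠ 0}) (j : ρ) => P j i.1)ᵀ
        * Matrix.diagonal (fun i : {i // hC.eigenvalues i ≠ 0} => hC.eigenvalues i.1)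
        * (Matrix.of fun (i : {i // hC.eigenvalues i ≠ 0}) (j : ρ) => P j i.1)) j j'
      = ∑ i : {i // hC.eigenvalues i ≠ 0}, P j i.1 * lam i.1 * P j' i.1 := by
    rw [Matrix.mul_apply]
    refine Finset.sum_congr rfl fun i _ => ?_
    rw [Matrix.mul_diagonal, Matrix.transpose_apply, Matrix.of_apply, Matrix.of_apply]
  rw [hL, hR]
  -- drop the vanishing terms
  rw [← Finset.sum_filter_of_ne (p := fun i => hC.eigenvalues i ≠ 0)
        (fun i _ hne => by
          intro h0
          apply hne
          rw [show lam i = hC.eigenvalues i from rfl, h0, mul_zero, zero_mul]),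
    Finset.sum_subtype (Finset.univ.filter fun i => hC.eigenvalues i ≠ 0) (p := fun i => hC.eigenvalues i ≠ 0)
      (fun i => by simp only [Finset.mem_filter, Finset.mem_univ, true_and])
      (fun i => P j i * lam i * P j' i)]

/-- The diagonal of non-zero eigenvalues is non-degenerate. [folklore] -/
theorem isUnit_det_spectralDiag {C : Matrix ρ ρ ℝ} (hC : C.IsHermitian) :
    IsUnit (Matrix.diagonal (fun i : {i // hC.eigenvalues i ≠ 0} => hC.eigenvalues i.1)).det := by
  rw [Matrix.det_diagonal, isUnit_iff_ne_zero]
  exact Finset.prod_ne_zero_iff.2 fun i _ => i.2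

/-- **The number of non-zero eigenvalues is the rank.** (Mathlib) -/
theorem card_effective_eq_rank {C : Matrix ρ ρ ℝ} (hC : C.IsHermitian) :
    Fintype.card {i // hC.eigenvalues i ≠ 0} = C.rank :=
  hC.rank_eq_card_non_zero_eigs.symm

omit [DecidableEq ρ] in
/-- `rank(UᵀB⁻¹U) ≤ min(card ι, card ρ)`. [folklore] -/
theorem rank_gram_le_min (B : Matrix ι ι ℝ) (U : Matrix ι ρ ℝ) :
    (Uᵀ * B⁻¹ * U).rank ≤ min (Fintype.card ι) (Fintype.card ρ) :=
  le_min ((Matrix.rank_mul_le_right _ _).trans (Matrix.rank_le_card_height U)) (Matrix.rank_le_card_width _)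

/-! ## §2  Effective size = Gram rank -/

/-- **EFFECTIVE SIZE = GRAM RANK.**  `det B ≠ 0`, `B` symmetric, `σⱼ ≠ 0`, any exponents: with
`hC : (UᵀB⁻¹U).IsHermitian`, `P` its eigenvector matrix, `A_{ij} = P_{j i}` over the non-zero eigenvalues and
`S = diag(λᵢ)_{λᵢ≠0}`,
`Z₊(X^eB + U diag(σX^δ) Uᵀ) = Z₊(X^eS⁻¹ + A diag(σX^δ) Aᵀ)` — a word of size `rank(UᵀB⁻¹U)` with the same exponents
and signs. [folklore] -/
theorem card_posRoots_base_eq_spectral (B : Matrix ι ι ℝ) (hB : IsUnit B.det) (U : Matrix ι ρ ℝ) (σ : ρ → ℝ)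
    (hσ : ∀ j, σ j ≠ 0) (e : ℕ) (δ : ρ → ℕ) (hC : (Uᵀ * B⁻¹ * U).IsHermitian) :
    ((Matrix.det (𝔽ₛ[e, B, U, σ, δ])).roots.toFinset.filter (fun t => 0 < t)).card
      = ((Matrix.det (𝔽ₛ[e,
            (Matrix.diagonal (fun i : {i // hC.eigenvalues i ≠ 0} => hC.eigenvalues i.1))⁻¹,
            (Matrix.of fun (i : {i // hC.eigenvalues i ≠ 0}) (j : ρ) =>
              (hC.eigenvectorUnitary : Matrix ρ ρ ℝ) j i.1),
            σ, δ])).roots.toFinset.filter (fun t => 0 < t)).card := by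
  classical
  exact card_posRoots_base_eq_card_posRoots_reduced B hB U σ hσ e δ _ (isUnit_det_spectralDiag hC) _
    (eq_spectralFactor hC)

end GramDual

end Summit.ValiantsHypothesis.ValiantsHypothesis.Theorems.LacunarySymmetroidMatrixDescartes
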